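import Summits.BirchSwinnertonDyer.BirchSwinnertonDyer.Theorems.PrintCFramBottomClassIndexLawFiveLeBorelNonScalarLeaf
import Summits.BirchSwinnertonDyer.BirchSwinnertonDyer.Theorems.PrintCFramBottomClassIndexLawFiveLeBorelH1Vanishing
import HarnessLib

/-!
# Route `PrintCFram`, crux C2 `BottomClassIndexLawFiveLe` (stmt-BirchSwinnertonDyer-20372), line
# `eisenstein-resource-bdp-line` (S2 `stub_kolyvaginUpper_borelCM`): **hCe — the SCALAR COMMUTANT of
# `ρ̄_{W,p}(Γ_{K''})` on `W[p]`** for the Borel CM-ramified class and every quadratic `K'' ∌ √−p`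
# (cell `bsd-print-cfram`, seat `bsd-line-cfram-p1-w4` g3; helper `--supports` 20372; 0 facts, 0 defs)

HONEST FRAMING. Nothing about BSD is proved here, and nothing of S2 itself. This file proves ONE named
input of the tree's Kolyvagin machine (`HeegnerPointsKolyvagin*`, McCallum 1991 / Gross 1991) at the
Borel prime: the hypothesis `hCe = KolyvaginImage.exists_eq_zsmul` («an additive endomorphism of `E[p]`
commuting with `Γ_K` is an integer scalar», Gross 1991, proof of Prop. 9.3), which the machine derives
from `HasSurjectiveModNGaloisRep` — false on the class — is here a THEOREM on the class for every
quadratic number field `K` with `−p ∉ K²` (all Heegner fields `K''` of the class, since `p ∣ N` splits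
in `K''`). It FAILS over `K = ℚ(√−p)` itself (there `ρ̄(Γ_K)` is abelian), whence the hypothesis.
The crux's S2 machine map (`Lines/eisenstein-resource-bdp-line-w2g5-S2-machine-map.md`) listed hCe as
OPEN; with (α) (w2 g5 p637675/p638259) and (β) (w4 g2 p635898) this leaves the visibility step (γ)
(Gross Prop. 9.3's conclusion for the reducible `W[p]`) as the only image-dependent input of S2.

MECHANISM (no CM main theorem, no Lubin–Tate, no Chebotarev; kit 0). In a frame of `W[p]`
(`exists_frame_galoisRepTorsion_rat`) the twist endomorphism `μ = √−p`
(`BorelHomothety.exists_sqrt_end_of_cmRamified`) is a matrix `A ≠ 0` with `A² = 0`; the non-scalar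
`σ ∈ Γ_ℚ` of `…BorelNonScalarLeaf` FIXES `√−p`, so `ρ̄(σ)` commutes with `A` and `ρ̄(σ) = u + vA` with
`u, v ≠ 0` (`BorelHomothety.exists_eq_smul_one_add_smul_of_commute_of_ne`), and `σ² ∈ res Γ_K`
(index `2`) gives `ρ̄(σ²) = u² + 2uvA ∈ ρ̄(res Γ_K)`; an additive `F` commuting with `ρ̄(res Γ_K)`
therefore commutes with `A` (`2uv ≠ 0`, `p` odd), so `F = s + tA`; some `c ∈ Γ_K` negates `√−p`
(`BorelHomothety.exists_restrict_smul_eq_neg`), `ρ̄(res c)` ANTI-commutes with `A`, and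
`F·ρ̄(c) = ρ̄(c)·F` forces `2t·Aρ̄(c) = 0`, i.e. `t = 0`: `F` is the scalar `s`.

* `exists_eq_zsmul_of_commute_restrict` — the ℚ̄-side statement (`W.geomTorsion p ⊂ W(ℚ̄)`, `Γ_K`
  acting through `absGaloisRestrict ℚ K`);
* **`exists_eq_zsmul_of_cmRamified`** — the machine's currency: `geomTorsion (W.baseChange K) p ⊂ E(K̄)`
  with `absoluteGaloisGroup K`, transported along `RatClosure.torsionEquiv`.

THEOREMS ONLY; no definition, no named fact, no `sorry`; imports no `Theses` module. BSD is not
proved by any of this; no summit statement is proved by this seat.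
References: [GrossLMS1991] §9, proof of Prop. 9.3 («Hom_𝒢(Gal(L_S/L), E_p) ≃ (ℤ/pℤ)^s»);
[McCallum1991] §3 (2); [SilvermanAEC2009] III.§7, X.5 Prop. 5.4.
-/

set_option autoImplicit false
-- `…BirchSwinnertonDyer.BirchSwinnertonDyer.Theorems…` is the problem's mandated namespace (D-0017).
set_option linter.dupNamespace false

noncomputable section

open scoped Classical NumberField Matrix

namespace Summit.BirchSwinnertonDyer.BirchSwinnertonDyer.Theorems.PrintCFram.BorelNonScalar

open WeierstrassCurve Field IsDedekindDomain NumberField Rat.HeightOneSpectrum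
  Literature.NumberTheory.EllipticCurves Literature.NumberTheory.GaloisRepresentations
  Literature.NumberTheory.EllipticCurves.PolyCert Literature.NumberTheory.EllipticCurves.CMIsogenyCert
  Literature.NumberTheory.EllipticCurves.Rank1Residual Summit.BirchSwinnertonDyer.Rank1Residual
  Summit.BirchSwinnertonDyer.Rank1Residual.X12.O11
  Summit.BirchSwinnertonDyer.BirchSwinnertonDyer.Rank1Residual

/-! ## §3 The scalar commutant of `ρ̄_{W,p}(Γ_K)` on `W[p]`, for every quadratic `K ∌ √−p` -/

section Commutant

open Summit.BirchSwinnertonDyer.BirchSwinnertonDyer.Theorems.PrintCFram.BorelHomothety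

variable (W : WeierstrassCurve ℚ) [W.IsElliptic] (p : ℕ) [hp : Fact p.Prime]
  (K : Type) [Field K] [NumberField K]

/-- **hCe over `ℚ̄`: the commutant of `ρ̄_{W,p}(res Γ_K)` in `End W[p]` is `ℤ·1`.** For `W/ℚ` elliptic
with CM, `p ≥ 5` ramified in the CM field, and a quadratic field `K` with `−p ∉ K²`: every additive
endomorphism `f` of `W[p] ⊂ W(ℚ̄)` commuting with the restrictions `res g`, `g ∈ Γ_K`, is an integer
scalar. In a frame of `W[p]`: `μ = √−p` is `A ≠ 0`, `A² = 0`; the non-scalar `σ` of §2 fixes `√−p`, so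
`ρ̄(σ) = u + vA` (`v ≠ 0`, `u ≠ 0`) and `ρ̄(σ²) = u² + 2uvA` with `σ² ∈ res Γ_K` (index `2`); `f`
commutes with it, hence with `A`, so `f = s + tA`; some `c ∈ Γ_K` negates `√−p`, `ρ̄(res c)`
anti-commutes with `A`, and `f ρ̄(c) = ρ̄(c) f` gives `2t·Aρ̄(c) = 0`, `t = 0`.
[cite: GrossLMS1991, §9 proof of Prop. 9.3 (Hom_𝒢(Gal(L_S/L), E_p) ≃ (ℤ/pℤ)^s)] -/
theorem exists_eq_zsmul_of_commute_restrict (hCM : W.HasCM) (h5 : 5 ≤ p) (hram : CMRamified W p)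
    (hK2 : Module.finrank ℚ K = 2) (hKp : ∀ y : K, y ^ 2 ≠ -(p : K))
    (f : W.geomTorsion (p : ℤ) →+ W.geomTorsion (p : ℤ))
    (hf : ∀ (g : absoluteGaloisGroup K) (Q : W.geomTorsion (p : ℤ)),
      f (absGaloisRestrict ℚ K g • Q) = absGaloisRestrict ℚ K g • f Q) :
    ∃ k : ℤ, ∀ Q, f Q = k • Q := by
  have hpr : p.Prime := hp.out
  haveI : NeZero p := ⟨hpr.ne_zero⟩
  letI : Module (ZMod p) (W.geomTorsion (p : ℤ)) := AddSubgroup.torsionBy.zmodModule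
  have h2 : (2 : ZMod p) ≠ 0 := by
    refine Ring.two_ne_zero ?_
    rw [ZMod.ringChar_zmod_n]
    omega
  -- the inputs: `μ = √−p`, the non-scalar `σ` fixing `s`, `σ² ∈ res Γ_K`, `c₀` negating `s`
  obtain ⟨s, μ, m, hs, hm, hμμ, hμ₁, hμ₂⟩ := exists_sqrt_end_of_cmRamified W p hCM h5 hram
  obtain ⟨σ, hσs, hσ⟩ := exists_frobenius_nonScalar_of_cmRamified p W hCM h5 hram hs
  obtain ⟨g₁, hg₁⟩ : σ ^ 2 ∈ (absGaloisRestrict ℚ K).range := by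
    have hHi : (absGaloisRestrict ℚ K).range.index = 2 :=
      (index_range_absGaloisRestrict_eq_finrank ℚ K).trans hK2
    haveI : (absGaloisRestrict ℚ K).range.Normal := Subgroup.normal_of_index_eq_two hHi
    haveI : (absGaloisRestrict ℚ K).range.FiniteIndex := ⟨by rw [hHi]; decide⟩
    have := Subgroup.pow_index_mem (absGaloisRestrict ℚ K).range σ
    rwa [hHi] at this
  change absGaloisRestrict ℚ K g₁ = σ ^ 2 at hg₁
  obtain ⟨c₀, hc₀⟩ := exists_restrict_smul_eq_neg p K hKp hs
  have hpm : (p : ℤ) ∣ m := Int.natCast_dvd.mpr (by rw [hm])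
  obtain ⟨P₀, hP₀, hμP₀⟩ := exists_mem_geomTorsion_apply_ne_zero W p hμμ hm
  -- a frame of `W[p]`
  obtain ⟨e, Φ, he, -, -, -, -⟩ := exists_frame_galoisRepTorsion_rat W p
  have hμmem : ∀ P : W.geomTorsion (p : ℤ), μ (P : W.geomPoints) ∈ W.geomTorsion (p : ℤ) := by
    intro P
    rw [AddSubgroup.torsionBy.nsmul_iff, ← map_nsmul, AddSubgroup.torsionBy.nsmul_iff.mp P.2, map_zero]
  set μV : W.geomTorsion (p : ℤ) →+ W.geomTorsion (p : ℤ) :=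
    { toFun := fun P => ⟨μ P, hμmem P⟩
      map_zero' := Subtype.ext (by simp)
      map_add' := fun P Q => Subtype.ext (by simp) } with hμV_def
  set A : Matrix (Fin 2) (Fin 2) (ZMod p) := LinearMap.toMatrix'
    ((e.toAddMonoidHom.comp (μV.comp e.symm.toAddMonoidHom)).toZModLinearMap p) with hA_def
  have hA : ∀ x : W.geomTorsion (p : ℤ), A *ᵥ e x = e (μV x) := by
    intro x
    rw [hA_def, LinearMap.toMatrix'_mulVec]
    change e (μV (e.symm (e x))) = e (μV x)
    rw [e.symm_apply_apply]
  set F : Matrix (Fin 2) (Fin 2) (ZMod p) := LinearMap.toMatrix'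
    ((e.toAddMonoidHom.comp (f.comp e.symm.toAddMonoidHom)).toZModLinearMap p) with hF_def
  have hF : ∀ x : W.geomTorsion (p : ℤ), F *ᵥ e x = e (f x) := by
    intro x
    rw [hF_def, LinearMap.toMatrix'_mulVec]
    change e (f (e.symm (e x))) = e (f x)
    rw [e.symm_apply_apply]
  set B : absoluteGaloisGroup ℚ → Matrix (Fin 2) (Fin 2) (ZMod p) :=
    fun τ => ((Φ (galoisRepTorsion W p τ) : GL (Fin 2) (ZMod p)) : Matrix (Fin 2) (Fin 2) (ZMod p))
    with hB_def
  have hB : ∀ (τ : absoluteGaloisGroup ℚ) (x : W.geomTorsion (p : ℤ)), e (τ • x) = B τ *ᵥ e x := by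
    intro τ x
    rw [hB_def]
    exact he (galoisRepTorsion W p τ) x
  have hext : ∀ {M N : Matrix (Fin 2) (Fin 2) (ZMod p)},
      (∀ x : W.geomTorsion (p : ℤ), M *ᵥ e x = N *ᵥ e x) → M = N := by
    intro M N hMN
    refine Matrix.ext_of_mulVec_single fun i => ?_
    obtain ⟨x, hx⟩ := e.surjective (Pi.single i 1)
    rw [← hx, hMN x]
  have hBmul : ∀ τ τ' : absoluteGaloisGroup ℚ, B (τ * τ') = B τ * B τ' := by
    intro τ τ'
    rw [hB_def]
    change ((Φ (galoisRepTorsion W p (τ * τ')) : GL (Fin 2) (ZMod p)) : Matrix (Fin 2) (Fin 2) (ZMod p)) = _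
    rw [map_mul, map_mul, Units.val_mul]
  have hB1 : B 1 = 1 := by
    rw [hB_def]
    change ((Φ (galoisRepTorsion W p 1) : GL (Fin 2) (ZMod p)) : Matrix (Fin 2) (Fin 2) (ZMod p)) = 1
    rw [map_one, map_one, Units.val_one]
  -- relations: `A ≠ 0`, `A² = 0`, `σ` commutes with `A`, `c₀` anti-commutes, `f` commutes with `res Γ_K`
  have hA0 : A ≠ 0 := by
    intro hA0
    apply hμP₀
    have h0 : e (μV ⟨P₀, hP₀⟩) = 0 := by rw [← hA, hA0, Matrix.zero_mulVec]
    rw [map_eq_zero_iff e e.injective] at h0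
    exact congrArg Subtype.val h0
  have hAA : A * A = 0 := hext fun x => by
    rw [← Matrix.mulVec_mulVec, hA, hA, Matrix.zero_mulVec, ← map_zero e]
    congr 1
    refine Subtype.ext ?_
    change μ (μ (x : W.geomPoints)) = 0
    obtain ⟨k, hk⟩ := hpm
    rw [hμμ, hk, mul_comm, ← smul_smul, natCast_zsmul, AddSubgroup.torsionBy.nsmul_iff.mp x.2, smul_zero]
  have hσA : B σ * A = A * B σ := hext fun x => by
    calc (B σ * A) *ᵥ e x = B σ *ᵥ (A *ᵥ e x) := (Matrix.mulVec_mulVec _ _ _).symm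
      _ = e (σ • μV x) := by rw [hA, ← hB]
      _ = e (μV (σ • x)) := by
        congr 1
        exact Subtype.ext (hμ₁ σ hσs x).symm
      _ = (A * B σ) *ᵥ e x := by rw [← Matrix.mulVec_mulVec, ← hB, hA]
  have hcA : B (absGaloisRestrict ℚ K c₀) * A = -(A * B (absGaloisRestrict ℚ K c₀)) := hext fun x => by
    calc (B (absGaloisRestrict ℚ K c₀) * A) *ᵥ e x
        = B (absGaloisRestrict ℚ K c₀) *ᵥ (A *ᵥ e x) := (Matrix.mulVec_mulVec _ _ _).symm
      _ = e (absGaloisRestrict ℚ K c₀ • μV x) := by rw [hA, ← hB]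
      _ = e (-(μV (absGaloisRestrict ℚ K c₀ • x))) := by
        congr 1
        refine Subtype.ext ?_
        change absGaloisRestrict ℚ K c₀ • μ (x : W.geomPoints) = -(μ (absGaloisRestrict ℚ K c₀ • (x : W.geomPoints)))
        rw [hμ₂ _ hc₀, neg_neg]
      _ = (-(A * B (absGaloisRestrict ℚ K c₀))) *ᵥ e x := by
        rw [Matrix.neg_mulVec, ← Matrix.mulVec_mulVec, ← hB, hA, map_neg]
  have hFB : ∀ g : absoluteGaloisGroup K,
      F * B (absGaloisRestrict ℚ K g) = B (absGaloisRestrict ℚ K g) * F := fun g => hext fun x => by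
    calc (F * B (absGaloisRestrict ℚ K g)) *ᵥ e x
        = F *ᵥ (B (absGaloisRestrict ℚ K g) *ᵥ e x) := (Matrix.mulVec_mulVec _ _ _).symm
      _ = e (f (absGaloisRestrict ℚ K g • x)) := by rw [← hB, hF]
      _ = e (absGaloisRestrict ℚ K g • f x) := by rw [hf]
      _ = (B (absGaloisRestrict ℚ K g) * F) *ᵥ e x := by rw [hB, ← hF, Matrix.mulVec_mulVec]
  -- Step 1: `B σ` is not a scalar
  have hSns : ∀ u : ZMod p, B σ ≠ u • (1 : Matrix (Fin 2) (Fin 2) (ZMod p)) := by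
    intro u hu
    obtain ⟨Q, hQ⟩ := hσ (u.val : ℤ)
    apply hQ
    apply e.injective
    rw [hB, hu, Matrix.smul_mulVec, Matrix.one_mulVec, map_zsmul,
      ← Int.cast_smul_eq_zsmul (ZMod p), Int.cast_natCast, ZMod.natCast_zmod_val]
  -- Step 2: `B σ = u + vA`, `u, v ≠ 0`
  obtain ⟨u, v, huv⟩ :=
    exists_eq_smul_one_add_smul_of_commute_of_ne (ne_smul_one_of_mul_self_eq_zero hA0 hAA) hσA
  have hv0 : v ≠ 0 := by
    intro hv
    exact hSns u (by rw [huv, hv, zero_smul, add_zero])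
  have hu0 : u ≠ 0 := by
    intro hu
    rw [hu, zero_smul, zero_add] at huv
    have hval : B σ * B σ = 0 := by
      rw [huv, Matrix.smul_mul, Matrix.mul_smul, hAA, smul_zero, smul_zero]
    refine Units.ne_zero (Φ (galoisRepTorsion W p σ) * Φ (galoisRepTorsion W p σ)) ?_
    rw [Units.val_mul]
    exact hval
  have h2uv : 2 * u * v ≠ 0 := mul_ne_zero (mul_ne_zero h2 hu0) hv0
  -- Step 3: `B (res g₁) = B σ² = u² + 2uv A`
  have hH : B (absGaloisRestrict ℚ K g₁) =
      (u * u) • (1 : Matrix (Fin 2) (Fin 2) (ZMod p)) + (2 * u * v) • A := by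
    rw [hg₁, pow_two, hBmul, huv]
    simp only [add_mul, mul_add, Matrix.smul_mul, Matrix.mul_smul, Matrix.one_mul, Matrix.mul_one, hAA,
      smul_zero, add_zero, smul_smul]
    module
  -- Step 4: `F` commutes with `A`
  have hFA : F * A = A * F := by
    have h1 := hFB g₁
    rw [hH] at h1
    simp only [mul_add, add_mul, Matrix.mul_smul, Matrix.smul_mul, Matrix.mul_one, Matrix.one_mul] at h1
    exact smul_right_injective _ h2uv (add_left_cancel h1)
  -- Step 5: `F = s' + tA`
  obtain ⟨s', t, hst⟩ :=
    exists_eq_smul_one_add_smul_of_commute_of_ne (ne_smul_one_of_mul_self_eq_zero hA0 hAA) hFA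
  -- Step 6: `t = 0` from commuting with `B (res c₀)`, which anti-commutes with `A`
  have hCinv : A * B (absGaloisRestrict ℚ K c₀) * B (absGaloisRestrict ℚ K c₀⁻¹) = A := by
    rw [Matrix.mul_assoc, ← hBmul, ← map_mul, mul_inv_cancel, map_one, hB1, Matrix.mul_one]
  have hAC0 : A * B (absGaloisRestrict ℚ K c₀) ≠ 0 := by
    intro h0
    apply hA0
    rw [← hCinv, h0, Matrix.zero_mul]
  have ht : t = 0 := by
    have h1 := hFB c₀
    rw [hst] at h1
    simp only [mul_add, add_mul, Matrix.mul_smul, Matrix.smul_mul, Matrix.mul_one, Matrix.one_mul, hcA,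
      smul_neg] at h1
    -- `s'•C + t•(A C) = s'•C - t•(A C)`
    have h3 : (2 * t) • (A * B (absGaloisRestrict ℚ K c₀)) = 0 := by
      have h4 := add_left_cancel h1
      rw [mul_smul, two_smul]
      have : t • (A * B (absGaloisRestrict ℚ K c₀)) + t • (A * B (absGaloisRestrict ℚ K c₀)) = 0 :=
        by rw [eq_neg_iff_add_eq_zero.mp h4]
      exact this
    rcases smul_eq_zero.mp h3 with h5' | h5'
    · exact (mul_eq_zero.mp h5').resolve_left h2
    · exact absurd h5' hAC0
  -- Step 7: `f` is the scalar `s'`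
  refine ⟨(s'.val : ℤ), fun Q => ?_⟩
  apply e.injective
  rw [← hF, hst, ht, zero_smul, add_zero, Matrix.smul_mulVec, Matrix.one_mulVec, map_zsmul,
    ← Int.cast_smul_eq_zsmul (ZMod p), Int.cast_natCast, ZMod.natCast_zmod_val]

/-- **hCe in the machine's currency.** For `W/ℚ` elliptic with CM, `p ≥ 5` ramified in the CM field,
and a quadratic number field `K` with `−p ∉ K²` (every Heegner field of the class): an additive
endomorphism of `E[p] = geomTorsion (W.baseChange K) p ⊂ E(K̄)` commuting with `Γ_K` is an integer
scalar — the hypothesis `hCe` (`KolyvaginImage.exists_eq_zsmul`) of Gross 1991 Prop. 9.3 /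
McCallum (2) in the tree's Kolyvagin machine, WITHOUT `HasSurjectiveModNGaloisRep` (false here).
Transport of `exists_eq_zsmul_of_commute_restrict` along `RatClosure.torsionEquiv`.
[cite: GrossLMS1991, §9 proof of Prop. 9.3 (Hom_𝒢(Gal(L_S/L), E_p) ≃ (ℤ/pℤ)^s)] -/
theorem exists_eq_zsmul_of_cmRamified (hCM : W.HasCM) (h5 : 5 ≤ p) (hram : CMRamified W p)
    (hK2 : Module.finrank ℚ K = 2) (hKp : ∀ y : K, y ^ 2 ≠ -(p : K))
    (f : geomTorsion (W.baseChange K) (p : ℤ) →+ geomTorsion (W.baseChange K) (p : ℤ))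
    (hf : ∀ (g : absoluteGaloisGroup K) (t : geomTorsion (W.baseChange K) (p : ℤ)), f (g • t) = g • f t) :
    ∃ k : ℤ, ∀ t, f t = k • t := by
  set θ := RatClosure.torsionEquiv (K := K) W (p : ℤ) with hθ
  set f₀ : W.geomTorsion (p : ℤ) →+ W.geomTorsion (p : ℤ) :=
    θ.symm.toAddMonoidHom.comp (f.comp θ.toAddMonoidHom) with hf₀_def
  have hf₀ : ∀ (g : absoluteGaloisGroup K) (Q : W.geomTorsion (p : ℤ)),
      f₀ (absGaloisRestrict ℚ K g • Q) = absGaloisRestrict ℚ K g • f₀ Q := by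
    intro g Q
    change θ.symm (f (θ (absGaloisRestrict ℚ K g • Q))) = absGaloisRestrict ℚ K g • θ.symm (f (θ Q))
    rw [RatClosure.torsionEquiv_smul, hf]
    apply θ.injective
    rw [θ.apply_symm_apply, RatClosure.torsionEquiv_smul, θ.apply_symm_apply]
  obtain ⟨k, hk⟩ := exists_eq_zsmul_of_commute_restrict W p K hCM h5 hram hK2 hKp f₀ hf₀
  refine ⟨k, fun t => ?_⟩
  obtain ⟨Q, rfl⟩ := θ.surjective t
  have h := hk Q
  change θ.symm (f (θ Q)) = k • Q at h
  apply θ.symm.injective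
  rw [h, map_zsmul, θ.symm_apply_apply]

end Commutant

end Summit.BirchSwinnertonDyer.BirchSwinnertonDyer.Theorems.PrintCFram.BorelNonScalar
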